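import Summits.BirchSwinnertonDyer.Rank1Residual.X11b.CastellaErratum
import HarnessLib

/-!
# X11b, route R1 — the `Λ`-adic links behind the display (5.3), with the OPEN one isolated

HONEST FRAMING (cell `b2b-bsdres`, verbatim): the goal of the cell is to DELETE the
COMBINATION-SHAPED residual classes for ALL analytic-rank `≤ 1` curves over `ℚ` — "full BSD
formula for every rank `≤ 1` curve in class C" assembled STRICTLY from published theorems — so that
the rank-`≤ 1` remainder becomes exactly the CONSTRUCTION-SHAPED classes, which are TYPED
(missing-input `Prop`s), NOT attempted. This is not "finishing BSD". Sub-cell `b2b-bsdres-multr1-p1`,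
research route R1 for X11b; nothing here is asserted; the one theorem is valuation bookkeeping.

## Purpose and honesty note

`CastellaErratumChain.lean` takes the display (A) = Cas18 eq. (5.3) as its single open input. In
print, (5.3) is the composite of FOUR statements about objects the tree does not have — Castella's
anticyclotomic Selmer group `X_ac(E[p^∞]) = Sel_𝔭(K_∞, E[p^∞])^∨` (Cas18 Def. 2.2: relaxed at
`𝔭̄`, strict at `𝔭`, locally trivial at `w ∤ p`) and the anticyclotomic `p`-adic `L`-function
`L_p(f) ∈ Λ_{R₀}` of Cas18 Thm. 3.1 (Castella–Hsieh / BDP, extended to `p ∣ N`) — namely: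

* (IMC) erratum Thm. 1.1 — **OPEN** (unrefereed; its proof uses Fouquet–Wan arXiv:2107.13726
  Thm. 4.41, unrefereed): "`Ch_Λ(X_ac(E[p^∞]))` is `Λ`-torsion and `Ch_Λ(X_ac(E[p^∞]))Λ_{R₀} =
  (L_p(f))`". Used only through its value at the trivial character: `f_ac(0) · u = L_p(f)(𝟙)` in
  `R₀` for a unit `u`, hence `ord_p f_ac(0) = ord_p L_p(f)(𝟙)` (`R₀ = W(𝔽̄_p)` is unramified over
  `ℤ_p`, so `ord_p` extends with the same normalisation). This replaces Cas18 Thm. 4.4, whose proof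
  via Thm. 4.2 is WITHDRAWN at `p ‖ N` (the point `φ ∈ 𝒳_𝕀^a`).
* (CTL) Cas18 Thm. 2.3, case `p ∣ N` — **PUB** (Camb. J. Math. 6 (2018) §2.2, from JSW 2017 Thm.
  3.3.1; not touched by the erratum): "Let `Σ` be any set of places of `K` not dividing `p`, and
  assume that `rank_ℤ(E(K)) = 1` and that `#Ш(E/K)[p^∞] < ∞`. Then `X_ac^Σ(E[p^∞])` is
  `Λ`-torsion, and letting `f_ac^Σ(T) ∈ Λ` be a generator of `Ch_Λ(X_ac^Σ(E[p^∞]))`, we have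
  `#ℤ_p/f_ac^Σ(0) = #Ш(E/K)[p^∞] · (#ℤ_p/((1 − a_p p⁻¹ + ε_p) log_{ω_E} P) / [E(K) ⊗ ℤ_p : ℤ_p.P])²
  × ∏_{w∣N⁺, w∉Σ} c_w^{(p)}(E/K) · ∏_{w∈Σ} #H¹(K_w, E[p^∞])`, where `ε_p = p⁻¹` if `p ∤ N` and
  `ε_p = 0` otherwise, `P ∈ E(K)` is any point of infinite order, and `c_w^{(p)}(E/K)` is the
  `p`-part of the Tamagawa number of `E/K` at `w`" (`N⁺` = the product of the primes of `N` split in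
  `K`). Used with `Σ = ∅`, `P = P_K`, in valuations: `ord_p f_ac(0) = ord_p #Ш(E/K)[p^∞] +
  2(ord_p((1 − a_p p⁻¹) log_ω P_K) − ord_p[E(K):ℤP_K]) + ord_p ∏_{w ∣ N⁺} c_w(E/K)`
  (`ord_p [E(K) ⊗ ℤ_p : ℤ_p P] = ord_p [E(K) : ℤP]` for a finitely generated `E(K)`).
* (BDP) Cas18 Thm. 3.2, case `p ∣ N` — **PUB** (CJM §3, from Castella, J. Inst. Math. Jussieu 17
  (2018) [cas-split] and Bertolini–Darmon–Prasanna 2013; printed for `E` semistable and OPTIMAL,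
  Manin constant `c ∈ ℤ_(p)^×` by Mazur 1978): "The following equality holds up to a `p`-adic unit:
  `L_p(f,𝟙) = (1 − a_p p⁻¹ + ε_p)² · (log_{ω_E} P_K)²`". At `p ‖ N`: `a_p = ±1`, so
  `ord_p(1 − a_p p⁻¹) = −1` and `ord_p L_p(f)(𝟙) = 2(ord_p log_ω P_K − 1)`.
* (TAM-q) W. Zhang, Camb. J. Math. 2 (2014) (cited by Cas18 §5: "Since `E[p]` is ramified at `q`,
  we have `ord_p(c_w(E/K)) = 0` for every prime `w ∣ q`") — **PUB**: so `ord_p ∏_{w∣N⁺} c_w =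
  ord_p ∏_{all w} c_w` (places off `N` have `c_w = 1`; additive places of `N` are split in the
  erratum field and counted in `N⁺`; the only prime of `N` not in `N⁺` is the ramified `q`).

Since neither `X_ac` nor `L_p(f)` exists in the tree, these four statements are typed against a
SHADOW: the structure `LambdaAdicShadow` records the three numbers the §5 argument extracts from the
`Λ`-adic objects — `ord_p f_ac(0)`, `ord_p L_p(f)(𝟙)`, `ord_p log_{ω_E}(P_K)` — and the partial
Tamagawa valuation `ord_p ∏_{w ∣ N⁺} c_w(E/K)`, each pinned only by its docstring. The four links are
predicates on the shadow and on tree objects (`Ш(E/K)[p^∞]`, `[E(K):ℤP]`, `∏_w c_w(E/K)`), and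
`display53At_of_shadowLinks` checks that (IMC) ∘ (BDP) ∘ (CTL) ∘ (TAM-q) is exactly the display
(A). This isolates the OPEN statement at the finest level the tree can name — as a SHAPE: the
isolation is faithful on valuations and nominal on objects (constructing `Sel_𝔭(K_∞, E[p^∞])` on the
tree's `subgroupH1`/`localKerOver` machinery and `L_p(f)` from CM periods is the typed missing
CONSTRUCTION of the cell's X11b row, RESIDUAL-CASES §a.2: "a `p ‖ N` anticyclotomic IMC + `p`-adic
Waldspurger/BDP formula in refereed print"). Precedent: `KellerYin2024/AnomalousBSD` (typing note).
-/

noncomputable section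

open scoped Classical

open WeierstrassCurve NumberField Literature.NumberTheory.EllipticCurves
  Literature.NumberTheory.EllipticCurves.Rank1Residual
  Literature.NumberTheory.EllipticCurves.Rank1Residual.Typed

namespace Summit.BirchSwinnertonDyer.Rank1Residual.X11b

section Links

variable (W : WeierstrassCurve ℚ) (K : Type) [Field K] [NumberField K]

/-- **Shadow of the `Λ`-adic objects of Cas18 §§2–3 at `(E, p, K, P)`** (NOT constructed in the
tree; each field is pinned only by this docstring). For `Λ = ℤ_p⟦Γ⟧` the anticyclotomic Iwasawa
algebra of `K`, `X_ac = X_ac(E[p^∞])` the Pontryagin dual of `Sel_𝔭(K_∞, E[p^∞])` (Cas18 Def. 2.2),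
assumed `Λ`-torsion with `Ch_Λ(X_ac) = (f_ac)`, `L_p(f) ∈ Λ_{R₀}` the anticyclotomic `p`-adic
`L`-function of Cas18 Thm. 3.1, and `P ∈ E(K) ⊂ E(K_𝔭) = E(ℚ_p)`:
* `charValOrd = ord_p f_ac(0)` (independent of the generator; `f_ac(0) ≠ 0` under (CTL));
* `lpTrivOrd = ord_p L_p(f)(𝟙) ∈ ℤ` (valuation of `R₀ = W(𝔽̄_p)`, `ord_p p = 1`);
* `logOrd = ord_p log_{ω_E}(P)` for the formal-group logarithm of a Néron differential extended to
  `E(ℚ_p) ⊗ ℤ_p → ℚ_p` (`P` of infinite order, so `log_ω P ≠ 0`);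
* `tamSplitOrd = ord_p ∏_{w ∣ N⁺} c_w(E/K)`, `N⁺` the product of the primes of `N` split in `K`.
[cite: Castella2018, Def. 2.2, Thm. 2.3, Thm. 3.1 (arXiv:1704.06608 pp. 5–9) (shape only; nothing asserted)] -/
structure LambdaAdicShadow (P : (W.baseChange K).toAffine.Point) : Type where
  /-- `ord_p f_ac(0)` for a generator `f_ac` of `Ch_Λ(X_ac(E[p^∞]))`. -/
  charValOrd : ℤ
  /-- `ord_p L_p(f)(𝟙)`, the value of Castella's anticyclotomic `p`-adic `L`-function at `𝟙`. -/
  lpTrivOrd : ℤ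
  /-- `ord_p log_{ω_E}(P)` in `E(K_𝔭) = E(ℚ_p)`. -/
  logOrd : ℤ
  /-- `ord_p ∏_{w ∣ N⁺} c_w(E/K)` over the places of `K` above primes of `N` split in `K`. -/
  tamSplitOrd : ℕ

variable {W K} {P : (W.baseChange K).toAffine.Point}

/-- **(IMC) — OPEN: the erratum's Thm. 1.1 at the trivial character.** "`Ch_Λ(X_ac(E[p^∞]))` is
`Λ`-torsion and `Ch_Λ(X_ac(E[p^∞]))Λ_{R₀} = (L_p(f))`" (erratum p. 1; hypotheses =
`Thm11Hypotheses W p K`) gives, evaluating generators at `𝟙`, `ord_p f_ac(0) = ord_p L_p(f)(𝟙)`.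
UNREFEREED (web erratum, n.d.; proof via Fouquet–Wan arXiv:2107.13726 Thm. 4.41, unrefereed); it
REPLACES Cas18 Thm. 4.4 whose printed proof (via Thm. 4.2, "`φ ∈ 𝒳_𝕀^a`") is withdrawn at `p ‖ N`.
THE isolated open link of route R1. A predicate on the shadow; NEVER a theorem.
[claim: Castella2018Erratum, status: under-review] -/
def LambdaAdicShadow.IMCAtTrivialChar (S : LambdaAdicShadow W K P) : Prop :=
  S.charValOrd = S.lpTrivOrd

/-- **(BDP) — PUB: Cas18 Thm. 3.2 at `p ∣ N`** ("`L_p(f,𝟙) = (1 − a_p p⁻¹ + ε_p)² · (log_{ω_E} P_K)²`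
up to a `p`-adic unit", `ε_p = 0` at `p ∣ N`; from Castella JIMJ 17 (2018) and BDP 2013; printed
for `E` semistable and optimal, Manin constant a `p`-unit by Mazur 1978), in valuations at a
multiplicative `p ≥ 3` (`a_p = ±1`, `ord_p(1 − a_p p⁻¹) = −1`): `ord_p L_p(f)(𝟙) = 2(ord_p log_ω P_K − 1)`.
A predicate on the shadow at the Heegner point; nothing asserted.
[cite: Castella2018, Thm. 3.2 (arXiv:1704.06608 p. 9) (shape only; nothing asserted)] -/
def LambdaAdicShadow.WaldspurgerAt (S : LambdaAdicShadow W K P) : Prop :=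
  S.lpTrivOrd = 2 * (S.logOrd - 1)

variable (p : ℕ)

/-- **(CTL) — PUB: Cas18 Thm. 2.3 (anticyclotomic control), case `p ∣ N`, `Σ = ∅`, at the point
`P`** (CJM 6 (2018) §2.2, verbatim in the module docstring; from JSW 2017 Thm. 3.3.1), in
valuations: `ord_p f_ac(0) = ord_p #Ш(E/K)[p^∞] + 2·(ord_p((1 − a_p p⁻¹) log_ω P) − ord_p[E(K):ℤP])
+ ord_p ∏_{w∣N⁺} c_w(E/K)`, with `ord_p((1 − a_p p⁻¹) log_ω P) = logOrd − 1` and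
`ord_p [E(K) ⊗ ℤ_p : ℤ_p P] = ord_p [E(K) : ℤP]`. Its printed hypotheses `rank E(K) = 1`,
`Ш(E/K)[p^∞]` finite are Gross–Zagier–Kolyvagin for the erratum field. A predicate; nothing asserted.
[cite: Castella2018, Thm. 2.3 (arXiv:1704.06608 pp. 5–6) (shape only; nothing asserted)] -/
def LambdaAdicShadow.ControlAt (S : LambdaAdicShadow W K P) : Prop :=
  S.charValOrd =
    (padicValNat p (Nat.card (AddCommGroup.primaryComponent (W.baseChange K).sha p)) : ℤ) +
      2 * ((S.logOrd - 1) - (padicValNat p (AddSubgroup.zmultiples P).index : ℤ)) + S.tamSplitOrd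

/-- **(TAM-q) — PUB: the ramified prime contributes no `p` to the Tamagawa product over `K`**
(Cas18 §5: "Since `E[p]` is ramified at `q`, we have `ord_p(c_w(E/K)) = 0` for every prime
`w ∣ q` (see e.g. [zhang-Kolyvagin])"; with `c_w = 1` off `N` and every other prime of `N` split in
the erratum field): `ord_p ∏_{w∣N⁺} c_w(E/K) = ord_p ∏_w c_w(E/K)`. A predicate; nothing asserted.
[cite: Castella2018, §5 (arXiv:1704.06608 p. 12), from (5.2) to (5.3) (shape only; nothing asserted)] -/
def LambdaAdicShadow.TamagawaAtRamifiedAt (S : LambdaAdicShadow W K P) : Prop :=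
  (S.tamSplitOrd : ℤ) = padicValNat p (W.baseChange K).tamagawaProduct

/-- **The display (A) is exactly (IMC) ∘ (BDP) ∘ (CTL) ∘ (TAM-q)** — Cas18 §5, (5.1)–(5.3):
"By Theorem 4.4 [erratum: Theorem 1.1] and Proposition 3.2 we have the equalities
`#ℤ_p/f_ac(0) = #ℤ_p/L_p(f,𝟙) = #(ℤ_p/(1 − a_p p⁻¹ + ε_p) log_{ω_E} P_K)²` (5.1) … Theorem 2.3
(taking `Σ = ∅` and `P = P_K`) yields a formula for `#ℤ_p/f_ac(0)` that combined with (5.1)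
immediately leads to `ord_p(#Ш(E/K)[p^∞]) = 2·ord_p([E(K):ℤ.P_K]) − Σ_{w∣N⁺} ord_p(c_w(E/K))`
(5.2) … Since `E[p]` is ramified at `q` … (5.2) can be rewritten as `ord_p(#Ш(E/K)[p^∞]) =
2·ord_p([E(K):ℤ.P_K]) − Σ_{w∣N} ord_p(c_w(E/K))` (5.3)". For every shadow `S` at `(E,p,K,P)`
satisfying the four links, `Display53At W p K P` holds; the OPEN input is `S.IMCAtTrivialChar`
alone. Valuation bookkeeping (the shadow's numbers cancel). [cite: Castella2018, §5 (arXiv:1704.06608 p. 12), (5.1)–(5.3)] -/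
theorem display53At_of_shadowLinks [W.IsGloballyMinimal] (S : LambdaAdicShadow W K P)
    (hIMC : S.IMCAtTrivialChar) (hBDP : S.WaldspurgerAt) (hCTL : S.ControlAt p)
    (hTAM : S.TamagawaAtRamifiedAt p) : Display53At W p K P := by
  unfold LambdaAdicShadow.IMCAtTrivialChar at hIMC
  unfold LambdaAdicShadow.WaldspurgerAt at hBDP
  unfold LambdaAdicShadow.ControlAt at hCTL
  unfold LambdaAdicShadow.TamagawaAtRamifiedAt at hTAM
  unfold Display53At
  linarith

/-- Conversely the display determines the shadow's open equation: given (BDP), (CTL), (TAM-q), the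
display (A) holds iff (IMC) at the trivial character does — so on the published links the OPEN
content of route R1 is EXACTLY `ord_p f_ac(0) = ord_p L_p(f)(𝟙)`, no more. Bookkeeping. [folklore] -/
theorem imcAtTrivialChar_iff_display53At [W.IsGloballyMinimal] (S : LambdaAdicShadow W K P)
    (hBDP : S.WaldspurgerAt) (hCTL : S.ControlAt p) (hTAM : S.TamagawaAtRamifiedAt p) :
    S.IMCAtTrivialChar ↔ Display53At W p K P := by
  unfold LambdaAdicShadow.IMCAtTrivialChar
  unfold LambdaAdicShadow.WaldspurgerAt at hBDP
  unfold LambdaAdicShadow.ControlAt at hCTL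
  unfold LambdaAdicShadow.TamagawaAtRamifiedAt at hTAM
  unfold Display53At
  constructor <;> intro h <;> linarith

end Links

end Summit.BirchSwinnertonDyer.Rank1Residual.X11b

end
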